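import Literature.AnabelianGeometry.EtaleTheta.SettingModelTateCyclotomes
import Literature.AnabelianGeometry.EtaleTheta.SettingModelTateGroupLevel
import Literature.AnabelianGeometry.EtaleTheta.ThetaQuotientsOfCurveTopology
import Literature.AnabelianGeometry.EtaleTheta.Discharge.Sec1ThetaCompactOfYcl
import HarnessLib

/-!
# The R78 STAGE-2 root `ThetaSetting.modelχq p i j hj` («Tate shear», abc-iut-L2-t5's F5q): η′ + (R3) + `hYcl` ⇒ the
# TOPOLOGICAL root data — theta quotients Hausdorff, `Δ_Θ` and `(Δ^tp_Y)^Θ` COMPACT, `hΔ` — all unconditional (proof-only)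

Mochizuki, *The étale theta function …*, Publ. RIMS **45** (2009) [EtTh], §1, PRIMS p. 238 («a natural exact sequence of
abelian profinite groups `1 → Δ_Θ → (Δ^tp_Y)^Θ → (Δ^tp_Y)^ell → 1`») [cite: MochizukiEtTh2009, §1 p.12]; *Semi-graphs of
anabelioids* [SemiAnbd], Ex. 3.10 pp. 43–45 [cite: MochizukiSemiAnbd2006, Ex 3.10 p.45].  abc-iut cell, seat abc-iut-w5-d111
(gen 4); R78 cluster STAGE 2, consumer side of F5q (`SettingModelTateTheta` p437247, reached through abc-iut-L2-t8's
`SettingModelTateCyclotomes` p437770: `ThetaSetting.modelχq p i j hj` over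
abc-iut-w5-d249's `curveχq p i j`, theta quotients = abc-iut-L2-d1's `CurveTheta` package, `hYcl_modelχq`).  PROOF-ONLY
(0 definitions, 0 instances): the twin of this seat's `SettingModelChiThetaTopology` (p433963) at stage 2, assembled BY NAME
from this seat's `nonempty_groupLevelData_curveχq_holds` (SettingModelTateGroupLevel p434513), the GENERIC `CurveTheta`
topology facts (ThetaQuotientsOfCurveTopology p436302; `CurveTheta.t2Space_GTheta` is abc-iut-L2-t8's) and the gen-3
reductions of `Sec1ThetaCompactOfYcl` (p425959):

* `nonempty_groupLevelData_modelχq`, `isTempered_piTemp_modelχq`, `secondCountableTopology_piTemp_modelχq` — η′;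
* `isQuotientMap_toTheta_modelχq`, `isQuotientMap_thetaToEll_modelχq` — (R3) holds at `modelχq`;
* `t2Space_gtpTheta_modelχq`, `t2Space_gtpEll_modelχq`, `isClosed_deltaTheta_modelχq` (`Δ_Θ` Hausdorff / compact themselves
  are abc-iut-L2-t8's `t2Space_deltaTheta_modelχq` / `isCompact_deltaTheta_modelχq`, SettingModelTateCyclotomes p437770 —
  imported, not restated; the open-mapping route to `Δ_Θ` compact is recorded as an `example`);
* **`isCompact_dtpYTheta_modelχq`**, `compactSpace_deltaTheta_modelχq`, **`hDelta_modelχq`** — `(Δ^tp_Y)^Θ` is COMPACT at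
  the stage-2 model (open-mapping/completeness route through the bundle + `hYcl_modelχq`), the binder `hΔ : IsCompact Δ_Θ ∧ T2Space (Π^tp_X)^Θ` of GAP-LEDGER G-w5d187-1 DISCHARGED at `modelχq`
  (consumers: `IotaInvariantThetaInfty*`, the `CyclotomeTower` chain, `[T2Space ↥D.DeltaTheta]` instances).
HONEST LABEL: semi-synthetic model (not the tempered `π₁` of a curve) — consistency evidence only; classical topological
group theory; nothing of [EtTh]/[SemiAnbd] asserted; no side taken on [IUTchIII] Cor. 3.12.
-/

noncomputable section

namespace Literature.AnabelianGeometry.EtaleTheta.SettingModel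

open Literature.AnabelianGeometry.SemiGraphs Literature.AlgebraicGeometry.Frobenioids _root_.Topology

variable (p : ℕ) [Fact p.Prime] (i j : ℤ) (hj : Even j)

/-! ### η′ at `modelχq` (its tempered-curve layer IS `curveχq p i j`) -/

/-- abc-iut-L3's parameter bundle at the tempered-curve layer of `modelχq`. [cite: MochizukiSemiAnbd2006, Ex 3.10 p.45] -/
theorem nonempty_groupLevelData_modelχq :
    Nonempty (TemperedCurve.GroupLevelData (ThetaSetting.modelχq p i j hj).toTemperedCurve) :=
  nonempty_groupLevelData_curveχq_holds p i j

/-- `Π^tp_X` of `modelχq` is tempered. [cite: MochizukiSemiAnbd2006, Ex 3.10 p.43] -/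
theorem isTempered_piTemp_modelχq : IsTempered (ThetaSetting.modelχq p i j hj).PiTemp :=
  isTempered_PiTpχq p i j

/-- `Π^tp_X` of `modelχq` is Galois-countable. [cite: MochizukiSemiAnbd2006, Ex 3.10 p.43] -/
theorem secondCountableTopology_piTemp_modelχq : SecondCountableTopology (ThetaSetting.modelχq p i j hj).PiTemp :=
  secondCountableTopology_PiTpχq p i j

/-! ### (R3) and Hausdorffness at `modelχq` (generic `CurveTheta` facts, read on the record) -/

/-- **(R3), first half, at `modelχq`.** [cite: MochizukiEtTh2009, §1 p.12] -/
theorem isQuotientMap_toTheta_modelχq : IsQuotientMap (ThetaSetting.modelχq p i j hj).toTheta :=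
  CurveTheta.isQuotientMap_toTheta (curveχq p i j)

/-- **(R3), second half, at `modelχq`.** [cite: MochizukiEtTh2009, §1 p.12] -/
theorem isQuotientMap_thetaToEll_modelχq : IsQuotientMap (ThetaSetting.modelχq p i j hj).thetaToEll :=
  CurveTheta.isQuotientMap_thetaToEll (curveχq p i j)

/-- `(Π^tp_X)^Θ` of `modelχq` is Hausdorff (abc-iut-L2-t8's generic `CurveTheta.t2Space_GTheta`).
[cite: MochizukiEtTh2009, §1 p.12] -/
theorem t2Space_gtpTheta_modelχq : T2Space (ThetaSetting.modelχq p i j hj).GtpTheta :=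
  CurveTheta.t2Space_GTheta (curveχq p i j)

/-- `(Π^tp_X)^ell` of `modelχq` is Hausdorff. [cite: MochizukiEtTh2009, §1 p.12] -/
theorem t2Space_gtpEll_modelχq : T2Space (ThetaSetting.modelχq p i j hj).GtpEll :=
  CurveTheta.t2Space_GEll (curveχq p i j)

/-- `Δ_Θ` of `modelχq` is closed in `(Π^tp_X)^Θ`. [cite: MochizukiEtTh2009, §1 p.12] -/
theorem isClosed_deltaTheta_modelχq :
    IsClosed (((ThetaSetting.modelχq p i j hj).DeltaTheta : Subgroup (ThetaSetting.modelχq p i j hj).GtpTheta) :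
      Set (ThetaSetting.modelχq p i j hj).GtpTheta) :=
  CurveTheta.isClosed_ker_thetaToEll (curveχq p i j)

/-! ### Compactness: `Δ_Θ` and `(Δ^tp_Y)^Θ` are profinite at the stage-2 model -/

/-- **`(Δ^tp_Y)^Θ` of `modelχq` is COMPACT** («abelian profinite», [EtTh] p. 238). [cite: MochizukiEtTh2009, §1 p.12] -/
theorem isCompact_dtpYTheta_modelχq :
    IsCompact (((ThetaSetting.modelχq p i j hj).DtpYTheta : Subgroup (ThetaSetting.modelχq p i j hj).GtpTheta) :
      Set (ThetaSetting.modelχq p i j hj).GtpTheta) :=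
  (ThetaSetting.modelχq p i j hj).isCompact_dtpYTheta_of_groupLevelData (nonempty_groupLevelData_modelχq p i j hj).some
    (hYcl_modelχq p i j hj)

/-- `Δ_Θ` of `modelχq` is compact — second route, cross-check of abc-iut-L2-t8's coordinate proof: this seat's
`isCompact_deltaTheta_of_groupLevelData` (open mapping / completeness) at the bundle + `hYcl_modelχq`.
[cite: MochizukiEtTh2009, §1 p.12] -/
example : IsCompact (((ThetaSetting.modelχq p i j hj).DeltaTheta : Subgroup (ThetaSetting.modelχq p i j hj).GtpTheta) :
    Set (ThetaSetting.modelχq p i j hj).GtpTheta) :=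
  (ThetaSetting.modelχq p i j hj).isCompact_deltaTheta_of_groupLevelData (nonempty_groupLevelData_modelχq p i j hj).some
    (hYcl_modelχq p i j hj)

/-- `Δ_Θ` of `modelχq` is a compact space (subtype form). [cite: MochizukiEtTh2009, §1 p.12] -/
theorem compactSpace_deltaTheta_modelχq : CompactSpace ↥(ThetaSetting.modelχq p i j hj).DeltaTheta :=
  isCompact_iff_compactSpace.mp (isCompact_deltaTheta_modelχq p i j hj)

/-- **The binder `hΔ` of GAP-LEDGER G-w5d187-1 HOLDS at `modelχq`**: «`Δ_Θ` profinite inside the Hausdorff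
`(Π^tp_X)^Θ`». [cite: MochizukiEtTh2009, §1 p.12] -/
theorem hDelta_modelχq :
    IsCompact (((ThetaSetting.modelχq p i j hj).DeltaTheta : Subgroup (ThetaSetting.modelχq p i j hj).GtpTheta) :
      Set (ThetaSetting.modelχq p i j hj).GtpTheta) ∧ T2Space (ThetaSetting.modelχq p i j hj).GtpTheta :=
  ⟨isCompact_deltaTheta_modelχq p i j hj, t2Space_gtpTheta_modelχq p i j hj⟩

end Literature.AnabelianGeometry.EtaleTheta.SettingModel

end
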